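import Literature.Analysis.FluidPDE.PlanarPullbackTransport
import HarnessLib

/-!
# The diagonal frame `(u, v) = (x - y, x + y)`: conjugating explicit planar moves

Topic `Literature/Analysis/FluidPDE`. Fourth file of the explicit pullback calculus for the planar
transport equation (`PlanarPullbackKinematics.lean`, `PlanarPullbackTransport.lean`,
`PlanarGraphBandKinematics.lean`). The graph-band move of the latter describes bands around
graphs `y = T(t, x)`; a channel that turns a corner (east to south, say) is not a graph over `x`
or `y` but it IS a graph over the bisecting diagonal. This file provides the (linear, constant
Jacobian `2`) change of frame

  `A z = (z₀ - z₁, z₀ + z₁)` (`diagFrame`),  `A⁻¹ w = ((w₀ + w₁)/2, (w₁ - w₀)/2)` (`diagFrameInv`),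

and the conjugation of a move by it: a scalar `Θ(t, ·)` and a velocity `V(t, ·)` given in frame
coordinates become `Θ(t, A ·)` and `A⁻¹ V(t, A ·)` in physical coordinates, and

* the transport expression is invariant: `∂ₜ(Θ∘A) + D(Θ∘A)[A⁻¹ V∘A] = (∂ₜΘ + DΘ[V]) ∘ A`
  (`transportExpr_conj_diagFrame`), so transported frame fields give transported physical fields
  (`transport_conj_diagFrame`);
* the divergence is invariant: `div (A⁻¹ V ∘ A) = (div V) ∘ A` (`divergence_conj_diagFrame`,
  the trace of `A⁻¹ (DV) A`, computed in coordinates);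
* perpendicular gradients are mapped to perpendicular gradients:
  `A⁻¹ (∇⊥H)(A z) = ½ ∇⊥(H ∘ A)(z)` (`diagFrameInv_perp_fderiv`), i.e. the physical stream
  function of a conjugated move is `½ H ∘ A`;
* smoothness is preserved (`contDiff_diagFrame`, `contDiff_uncurry_conj_diagFrame`, …), and the
  elementary algebra of `A`, `A⁻¹` (inverse identities, values on the basis vectors, the
  derivative `DA = A`).

Graphs over the other diagonal direction are obtained by composing with the symmetries of the
square (`QuasiSelfSimilarSymmetry.lean`), so this one frame suffices. Folklore linear algebra and
chain rule; the file states no named fact. Infrastructure towards a discharge of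
`acm_compatible_blocks` (`QuasiSelfSimilarCompatibleBlocks.lean`).

## References

* G. Alberti, G. Crippa, A. L. Mazzucato, *Exponential self-similar mixing by incompressible
  flows*, J. Amer. Math. Soc. 32 (2019), 445–490, §8 (arXiv:1605.02090).
-/

noncomputable section

open Function Set Filter
open scoped Topology

namespace Literature.Analysis.FluidPDE

namespace PlanarKinematics

/-- The plane `ℝ²` as a Euclidean space. [folklore] -/
local notation "E²" => EuclideanSpace ℝ (Fin 2)

variable {G : Type*} [NormedAddCommGroup G] [NormedSpace ℝ G]

/-! ## The frame and its inverse -/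

/-- **The diagonal frame** `A z = (z₀ - z₁, z₀ + z₁)` (coordinates `u = x - y`, `v = x + y`;
unnormalised, Jacobian `2`). [folklore] -/
def diagFrame (z : E²) : E² := vec2 (z 0 - z 1) (z 0 + z 1)

/-- **The inverse frame map** `A⁻¹ w = ((w₀ + w₁)/2, (w₁ - w₀)/2)`. [folklore] -/
def diagFrameInv (w : E²) : E² := vec2 ((w 0 + w 1) / 2) ((w 1 - w 0) / 2)

/-- Unfolding `diagFrame`. [folklore] -/
@[simp]
theorem diagFrame_apply (z : E²) : diagFrame z = vec2 (z 0 - z 1) (z 0 + z 1) := rfl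

/-- Unfolding `diagFrameInv`. [folklore] -/
@[simp]
theorem diagFrameInv_apply (w : E²) : diagFrameInv w = vec2 ((w 0 + w 1) / 2) ((w 1 - w 0) / 2) := rfl

/-- `A⁻¹ ∘ A = id`. [folklore] -/
@[simp]
theorem diagFrameInv_diagFrame (z : E²) : diagFrameInv (diagFrame z) = z := by
  rw [diagFrame_apply, diagFrameInv_apply, vec2_apply_zero, vec2_apply_one]
  conv_rhs => rw [← vec2_apply_eq z]
  rw [vec2_eq_vec2_iff]
  constructor <;> ring

/-- `A ∘ A⁻¹ = id`. [folklore] -/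
@[simp]
theorem diagFrame_diagFrameInv (w : E²) : diagFrame (diagFrameInv w) = w := by
  rw [diagFrameInv_apply, diagFrame_apply, vec2_apply_zero, vec2_apply_one]
  conv_rhs => rw [← vec2_apply_eq w]
  rw [vec2_eq_vec2_iff]
  constructor <;> ring

/-- `A` is additive. [folklore] -/
theorem diagFrame_add (z z' : E²) : diagFrame (z + z') = diagFrame z + diagFrame z' := by
  simp only [diagFrame_apply, PiLp.add_apply, vec2_add_vec2, vec2_eq_vec2_iff]
  constructor <;> ring

/-- `A` is homogeneous. [folklore] -/
theorem diagFrame_smul (c : ℝ) (z : E²) : diagFrame (c • z) = c • diagFrame z := by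
  simp only [diagFrame_apply, PiLp.smul_apply, smul_eq_mul, smul_vec2, vec2_eq_vec2_iff]
  constructor <;> ring

/-- `A⁻¹` is additive. [folklore] -/
theorem diagFrameInv_add (w w' : E²) : diagFrameInv (w + w') = diagFrameInv w + diagFrameInv w' := by
  simp only [diagFrameInv_apply, PiLp.add_apply, vec2_add_vec2, vec2_eq_vec2_iff]
  constructor <;> ring

/-- `A⁻¹` is homogeneous. [folklore] -/
theorem diagFrameInv_smul (c : ℝ) (w : E²) : diagFrameInv (c • w) = c • diagFrameInv w := by
  simp only [diagFrameInv_apply, PiLp.smul_apply, smul_eq_mul, smul_vec2, vec2_eq_vec2_iff]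
  constructor <;> ring

/-- `A⁻¹` of a negated vector. [folklore] -/
theorem diagFrameInv_neg (w : E²) : diagFrameInv (-w) = -diagFrameInv w := by
  rw [← neg_one_smul ℝ w, diagFrameInv_smul, neg_one_smul]

/-- `A e₀ = e₀ + e₁ = (1, 1)`. [folklore] -/
theorem diagFrame_single_zero : diagFrame (EuclideanSpace.single 0 1) = vec2 1 1 := by
  rw [diagFrame_apply, vec2_eq_vec2_iff]; simp

/-- `A e₁ = -e₀ + e₁ = (-1, 1)`. [folklore] -/
theorem diagFrame_single_one : diagFrame (EuclideanSpace.single 1 1) = vec2 (-1) 1 := by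
  rw [diagFrame_apply, vec2_eq_vec2_iff]; simp

/-- `(1, 1) = e₀ + e₁` and `(-1, 1) = -e₀ + e₁` on the standard basis. [folklore] -/
theorem vec2_one_one : (vec2 1 1 : E²) = EuclideanSpace.single 0 1 + EuclideanSpace.single 1 1 := by
  simp [vec2]

/-- `(-1, 1) = -e₀ + e₁`. [folklore] -/
theorem vec2_neg_one_one : (vec2 (-1) 1 : E²) = -EuclideanSpace.single 0 1 + EuclideanSpace.single 1 1 := by
  simp [vec2]

/-! ## Derivatives of the frame maps -/

/-- **`A` as a continuous linear map** (its own derivative). [folklore] -/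
def diagFrameL : E² →L[ℝ] E² :=
  ((EuclideanSpace.proj (0 : Fin 2) : E² →L[ℝ] ℝ) - (EuclideanSpace.proj (1 : Fin 2) : E² →L[ℝ] ℝ)).smulRight
      (EuclideanSpace.single 0 1) +
    ((EuclideanSpace.proj (0 : Fin 2) : E² →L[ℝ] ℝ) + (EuclideanSpace.proj (1 : Fin 2) : E² →L[ℝ] ℝ)).smulRight
      (EuclideanSpace.single 1 1)

/-- The continuous linear map `diagFrameL` is `A`. [folklore] -/
@[simp]
theorem diagFrameL_apply (v : E²) : diagFrameL v = diagFrame v := by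
  simp only [diagFrameL, _root_.add_apply, ContinuousLinearMap.smulRight_apply,
    _root_.sub_apply, PiLp.proj_apply, diagFrame_apply, vec2]

/-- **`DA = A`** at every point. [folklore] -/
theorem hasFDerivAt_diagFrame (z : E²) : HasFDerivAt diagFrame diagFrameL z := by
  have h0 : HasFDerivAt (fun w : E² => w 0 - w 1)
      ((EuclideanSpace.proj (0 : Fin 2) : E² →L[ℝ] ℝ) - (EuclideanSpace.proj (1 : Fin 2) : E² →L[ℝ] ℝ)) z :=
    (EuclideanSpace.proj (0 : Fin 2) : E² →L[ℝ] ℝ).hasFDerivAt.sub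
      (EuclideanSpace.proj (1 : Fin 2) : E² →L[ℝ] ℝ).hasFDerivAt
  have h1 : HasFDerivAt (fun w : E² => w 0 + w 1)
      ((EuclideanSpace.proj (0 : Fin 2) : E² →L[ℝ] ℝ) + (EuclideanSpace.proj (1 : Fin 2) : E² →L[ℝ] ℝ)) z :=
    (EuclideanSpace.proj (0 : Fin 2) : E² →L[ℝ] ℝ).hasFDerivAt.add
      (EuclideanSpace.proj (1 : Fin 2) : E² →L[ℝ] ℝ).hasFDerivAt
  exact hasFDerivAt_vec2 h0 h1

/-- `A` is differentiable. [folklore] -/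
theorem differentiableAt_diagFrame (z : E²) : DifferentiableAt ℝ diagFrame z :=
  (hasFDerivAt_diagFrame z).differentiableAt

/-- `A` is smooth. [folklore] -/
theorem contDiff_diagFrame {n : WithTop ℕ∞} : ContDiff ℝ n diagFrame :=
  contDiff_vec2 ((contDiff_coord 0).sub (contDiff_coord 1)) ((contDiff_coord 0).add (contDiff_coord 1))

/-- `A⁻¹` is smooth. [folklore] -/
theorem contDiff_diagFrameInv {n : WithTop ℕ∞} : ContDiff ℝ n diagFrameInv :=
  contDiff_vec2 (((contDiff_coord 0).add (contDiff_coord 1)).div_const 2)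
    (((contDiff_coord 1).sub (contDiff_coord 0)).div_const 2)

/-- **Chain rule through the frame**: `D(Θ ∘ A)(z)[v] = DΘ(A z)[A v]`. [folklore] -/
theorem fderiv_comp_diagFrame_apply {Θ : E² → G} {z : E²} (hΘ : DifferentiableAt ℝ Θ (diagFrame z))
    (v : E²) : fderiv ℝ (fun w => Θ (diagFrame w)) z v = fderiv ℝ Θ (diagFrame z) (diagFrame v) := by
  have h : HasFDerivAt (fun w => Θ (diagFrame w)) ((fderiv ℝ Θ (diagFrame z)).comp diagFrameL) z :=
    hΘ.hasFDerivAt.comp z (hasFDerivAt_diagFrame z)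
  rw [h.fderiv, ContinuousLinearMap.comp_apply, diagFrameL_apply]

/-! ## Conjugated moves: transport and divergence -/

/-- **The transport expression is frame invariant**: for a scalar `Θ(t, ·)` and a velocity
`V(t, ·)` given in frame coordinates, the physical fields `Θ(t, A ·)` and `A⁻¹ V(t, A ·)` have, at
`(t, z)`, the transport expression of `(Θ, V)` at `(t, A z)`. [folklore] -/
theorem transportExpr_conj_diagFrame {Θ : ℝ → E² → G} (V : ℝ → E² → E²) {t : ℝ} {z : E²}
    (hΘ : DifferentiableAt ℝ (Θ t) (diagFrame z)) :
    deriv (fun s => Θ s (diagFrame z)) t +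
        fderiv ℝ (fun w => Θ t (diagFrame w)) z (diagFrameInv (V t (diagFrame z))) =
      deriv (fun s => Θ s (diagFrame z)) t + fderiv ℝ (Θ t) (diagFrame z) (V t (diagFrame z)) := by
  rw [fderiv_comp_diagFrame_apply hΘ, diagFrame_diagFrameInv]

/-- **Transported frame fields give transported physical fields.** [folklore] -/
theorem transport_conj_diagFrame {Θ : ℝ → E² → G} {V : ℝ → E² → E²} {t : ℝ} {z : E²}
    (hΘ : DifferentiableAt ℝ (Θ t) (diagFrame z))
    (h : deriv (fun s => Θ s (diagFrame z)) t + fderiv ℝ (Θ t) (diagFrame z) (V t (diagFrame z)) = 0) :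
    deriv (fun s => Θ s (diagFrame z)) t +
      fderiv ℝ (fun w => Θ t (diagFrame w)) z (diagFrameInv (V t (diagFrame z))) = 0 := by
  rw [transportExpr_conj_diagFrame V hΘ, h]

/-- `A⁻¹` as a continuous linear map (the derivative of `diagFrameInv`). [folklore] -/
def diagFrameInvL : E² →L[ℝ] E² :=
  ((2 : ℝ)⁻¹ • ((EuclideanSpace.proj (0 : Fin 2) : E² →L[ℝ] ℝ) + (EuclideanSpace.proj (1 : Fin 2) : E² →L[ℝ] ℝ))).smulRight
      (EuclideanSpace.single 0 1) +
    ((2 : ℝ)⁻¹ • ((EuclideanSpace.proj (1 : Fin 2) : E² →L[ℝ] ℝ) - (EuclideanSpace.proj (0 : Fin 2) : E² →L[ℝ] ℝ))).smulRight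
      (EuclideanSpace.single 1 1)

/-- The continuous linear map `diagFrameInvL` is `A⁻¹`. [folklore] -/
@[simp]
theorem diagFrameInvL_apply (v : E²) : diagFrameInvL v = diagFrameInv v := by
  simp only [diagFrameInvL, _root_.add_apply, ContinuousLinearMap.smulRight_apply,
    _root_.sub_apply, _root_.smul_apply, PiLp.proj_apply, diagFrameInv_apply,
    vec2, smul_eq_mul]
  congr 1 <;> ring_nf

/-- **Derivative of a conjugated velocity**: `D(A⁻¹ V ∘ A)(z) = A⁻¹ ∘ DV(A z) ∘ A`. [folklore] -/
theorem hasFDerivAt_conj_diagFrame {V : E² → E²} {z : E²} (hV : DifferentiableAt ℝ V (diagFrame z)) :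
    HasFDerivAt (fun w => diagFrameInv (V (diagFrame w)))
      (diagFrameInvL.comp ((fderiv ℝ V (diagFrame z)).comp diagFrameL)) z := by
  have h1 : HasFDerivAt (fun w => V (diagFrame w)) ((fderiv ℝ V (diagFrame z)).comp diagFrameL) z :=
    hV.hasFDerivAt.comp z (hasFDerivAt_diagFrame z)
  have h2 : HasFDerivAt diagFrameInv diagFrameInvL (V (diagFrame z)) := by
    have h := diagFrameInvL.hasFDerivAt (x := V (diagFrame z))
    have e : (diagFrameInvL : E² → E²) = diagFrameInv := funext diagFrameInvL_apply
    rw [e] at h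
    exact h
  exact h2.comp z h1

/-- **The divergence is frame invariant**: `div (A⁻¹ V ∘ A)(z) = div V (A z)` (the trace of
`A⁻¹ (DV) A` is the trace of `DV`; in coordinates, with `M = DV(Az)`:
`[A⁻¹ M (e₀+e₁)]₀ + [A⁻¹ M (-e₀+e₁)]₁ = (M e₀)₀ + (M e₁)₁`). [folklore] -/
theorem divergence_conj_diagFrame {V : E² → E²} {z : E²} (hV : DifferentiableAt ℝ V (diagFrame z)) :
    ∑ j, fderiv ℝ (fun w => diagFrameInv (V (diagFrame w))) z (EuclideanSpace.single j 1) j =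
      ∑ j, fderiv ℝ V (diagFrame z) (EuclideanSpace.single j 1) j := by
  set M := fderiv ℝ V (diagFrame z) with hM
  rw [(hasFDerivAt_conj_diagFrame hV).fderiv, Fin.sum_univ_two, Fin.sum_univ_two]
  simp only [ContinuousLinearMap.comp_apply, diagFrameL_apply, diagFrameInvL_apply,
    diagFrame_single_zero, diagFrame_single_one, vec2_one_one, vec2_neg_one_one, map_add, map_neg]
  simp only [diagFrameInv_apply, vec2_apply_zero, vec2_apply_one, PiLp.add_apply, PiLp.neg_apply]
  ring

/-- **Divergence-free frame fields give divergence-free physical fields.** [folklore] -/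
theorem divergence_conj_diagFrame_eq_zero {V : E² → E²} {z : E²}
    (hV : DifferentiableAt ℝ V (diagFrame z))
    (h : ∑ j, fderiv ℝ V (diagFrame z) (EuclideanSpace.single j 1) j = 0) :
    ∑ j, fderiv ℝ (fun w => diagFrameInv (V (diagFrame w))) z (EuclideanSpace.single j 1) j = 0 := by
  rw [divergence_conj_diagFrame hV, h]

/-! ## Stream functions through the frame -/

/-- **Perpendicular gradients are mapped to perpendicular gradients**:
`A⁻¹ (∂₁H, -∂₀H)(A z) = ½ (∂₁(H∘A), -∂₀(H∘A))(z)`, i.e. if `V = ∇⊥H` in frame coordinates then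
the physical velocity `A⁻¹ V ∘ A` is `∇⊥` of the physical stream function `½ H ∘ A` (`½ = 1/det A`).
[folklore] -/
theorem diagFrameInv_perp_fderiv {H : E² → ℝ} {z : E²} (hH : DifferentiableAt ℝ H (diagFrame z)) :
    diagFrameInv (vec2 (fderiv ℝ H (diagFrame z) (EuclideanSpace.single 1 1))
        (-fderiv ℝ H (diagFrame z) (EuclideanSpace.single 0 1))) =
      vec2 (2⁻¹ * fderiv ℝ (fun w => H (diagFrame w)) z (EuclideanSpace.single 1 1))
        (-(2⁻¹ * fderiv ℝ (fun w => H (diagFrame w)) z (EuclideanSpace.single 0 1))) := by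
  rw [fderiv_comp_diagFrame_apply hH, fderiv_comp_diagFrame_apply hH, diagFrame_single_zero,
    diagFrame_single_one, vec2_one_one, vec2_neg_one_one, map_add, map_add, map_neg, diagFrameInv_apply,
    vec2_apply_zero, vec2_apply_one, vec2_eq_vec2_iff]
  constructor <;> ring

/-! ## Smoothness of conjugated fields -/

/-- **A scalar read through the frame is as smooth** (jointly in `(t, z)`). [folklore] -/
theorem contDiff_uncurry_comp_diagFrame {Θ : ℝ → E² → G} {n : WithTop ℕ∞} (hΘ : ContDiff ℝ n (uncurry Θ)) :
    ContDiff ℝ n (uncurry fun t z => Θ t (diagFrame z)) :=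
  hΘ.comp (contDiff_fst.prodMk (contDiff_diagFrame.comp contDiff_snd))

/-- **A conjugated velocity is as smooth** (jointly in `(t, z)`). [folklore] -/
theorem contDiff_uncurry_conj_diagFrame {V : ℝ → E² → E²} {n : WithTop ℕ∞} (hV : ContDiff ℝ n (uncurry V)) :
    ContDiff ℝ n (uncurry fun t z => diagFrameInv (V t (diagFrame z))) :=
  contDiff_diagFrameInv.comp (hV.comp (contDiff_fst.prodMk (contDiff_diagFrame.comp contDiff_snd)))

/-- Slices of a conjugated scalar are differentiable where the frame scalar is. [folklore] -/
theorem differentiableAt_comp_diagFrame {Θ : E² → G} {z : E²} (hΘ : DifferentiableAt ℝ Θ (diagFrame z)) :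
    DifferentiableAt ℝ (fun w => Θ (diagFrame w)) z :=
  hΘ.comp z (differentiableAt_diagFrame z)

end PlanarKinematics

end Literature.Analysis.FluidPDE
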